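import Literature.Geometry.Lorentzian.KerrRedShiftTimelike
import Literature.Geometry.Lorentzian.KerrDomainOfDependence
import Literature.Geometry.Lorentzian.KerrSchildMultiplierDEC
import HarnessLib

/-!
# The boundary terms of the red-shift identity have signs near the Kerr horizon: the `J^N`-flux
# through the admissible leaves and through the receding inner hypersurfaces
# (Dafermos–Rodnianski–Shlapentokh-Rothman, §2.3.2 and Prop. 4.5.2, dominant energy condition)

(family `gr`; namespace `Literature.Geometry.Lorentzian.Kerr`; written from the proving seat of the
named fact
`Literature.Geometry.Lorentzian.DafermosRodnianskiShlapentokhRothman2016_energyBoundedness_horizonRegular`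
(`KerrHorizonRegularWaveBoundedness.lean`), third step towards the red-shift estimate Prop. 4.5.2 of
DRSR arXiv:1402.7034 for the horizon-regular class, after `KerrRedShiftCoercivity.lean` (the bulk)
and `KerrRedShiftTimelike.lean` (`N` timelike and transversal on a collar). No named fact is
introduced (D-0026); everything is proved.)

The energy identity (ingeneralform2) of DRSR §2.3.2 for the red-shift multiplier `N` on the region
bounded by two leaves `Σ̃_{τ₁}`, `Σ̃_{τ₂}` and the event horizon is useful because its boundary terms
have signs: `∫_{Σ̃_τ} J^N_μ n^μ ≥ 0` and `∫_{𝓗⁺} J^N_μ n^μ ≥ 0` for `N` future timelike (dominant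
energy condition). In the Kerr–Schild chart, with the raised coordinate current
`(J^N)^μ = T^μ{}_ν N^ν = KerrSchild.multiplierCurrent G N` (`KerrSchildMultiplierCurrent.lean`) and
the horizon replaced by the receding spacelike hypersurfaces `{(r − r₊)e^{−t*/(2M)} = const}` of
`KerrDomainOfDependence.lean` (`Kerr.horizonFn`), this file proves the two signs on the collar of
`KerrRedShiftTimelike.lean`:

* `Kerr.redShiftCovector` — the lowered covector `ξ = g(N, ·)` with `N = g⁻¹ξ`
  (`redShiftVector_eq_sum_inverseMetric_mul_redShiftCovector`), `G(ξ, ξ) = g(N, N)`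
  (`toBilin'_inverseMetric_redShiftCovector_self`) and `G(ξ, n) = n(N)`
  (`toBilin'_inverseMetric_redShiftCovector`): the form in which the dominant energy condition of
  `KerrSchildMultiplierDEC.lean` takes the multiplier;
* `Kerr.surgeryBackground_inverseMetric_eq` — on `{r ≥ r₀}` the surgered background of
  `KerrSchildWaveCauchyProblem.lean` has the Kerr inverse metric (pointwise form of
  `Kerr.surgeryBackground_inverseMetric_eventuallyEq`), so its cone structure
  (`KerrSchild.Background.sum_multiplierCurrent_mul_nonneg`) is available at exterior points;
* `Kerr.toBilin'_inverseMetric_admissible_nonpos` — admissible conormals `n = (1, −q)`, `|q| ≤ 1`,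
  are causal: `G(n, n) ≤ −1 + |q|² ≤ 0`;
* `Kerr.neg_sum_redShiftCurrent_mul_nonneg` (**the leaf term**): at an exterior point where
  `g(N, N) < 0` and `n(N) > 0` for an admissible conormal `n` — both provided on the collar by
  `Kerr.exists_redShift_timelike_collar` — `0 ≤ −∑_μ (J^N)^μ n_μ` (the `N`-energy density through
  the leaf `{t* = τ + F(x⃗)}`, `n = dt* − dF`, `‖∇F‖ ≤ 1`);
* `Kerr.redShift_horizonFactor_flux` (**the receding inner boundary term**): at an exterior point
  where `g(N, N) < 0`, `N⁰ ≥ 0` and `1 + f₁(r − r₊) > 0`, for every `ε > 0`,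
  `0 ≤ ∑_μ ∂_μ[χ(u₂/ε − 1)] (J^N)^μ`, `u₂ = Kerr.horizonFn`, `χ = Real.smoothTransition`: the
  differential of the factor is `−k ν`, `k ≥ 0`, with `ν = ṡ dt* − dr` a past causal covector
  (`Kerr.horizonCovector_causal`), i.e. `−ν` is future causal, and
  `(−ν)(N) = −(ṡN⁰ + (1 + f₁(r − r₊))) < 0`
  (`N(r) = −(1 + f₁(r − r₊))`: `K(r) = 0`, `ℓ♯(r) = 1`), so `∑ ν_μ (J^N)^μ ≤ 0` by the dominant
  energy condition — the opposite sign to the `dt♯`-current of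
  `Kerr.horizonFactor_flux`, as it must be for a future-directed multiplier;
* `KerrSchild.Background.abs_multiplierCurrent_le` — `|(J^X)^μ| ≤ 6(1 + Φ)Ξ ∑_κ(∂_κw)²` when
  `|X^α| ≤ Ξ` (the size of the current, for the cut-off errors), and
  `Kerr.exists_forall_abs_le_of_continuousOn_slab` — a `t*`-invariant function continuous on
  `{r > 0}` is bounded on `{r₀ ≤ r ≤ R}` (`r₀ > 0`), whence bounds `Ξ` for the components of `N`
  (`Kerr.exists_abs_redShiftVector_le`).

## References

* M. Dafermos, I. Rodnianski, Y. Shlapentokh-Rothman, Ann. of Math. 183 (2016), arXiv:1402.7034: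
  §2.3.2 ((ingeneralform2): the boundary terms and their signs), §4.5 Props. 4.5.1–4.5.2
  (key `DafermosRodnianskiShlapentokhrothman2014`).
* M. Dafermos, I. Rodnianski, *Lectures on black holes and linear waves*, arXiv:0811.0354, App. C–D
  (dominant energy condition, `J^V_μ n^μ ≥ 0`) (key `DafermosRodnianski2008`).
* S. W. Hawking, G. F. R. Ellis, *The large scale structure of space-time*, CUP 1973, §4.3
  (key `HawkingEllis1973CUP`).
-/

noncomputable section

open Set Filter Metric
open scoped Topology

namespace Literature.Geometry.Lorentzian

/-! ## Part 0. The size of a multiplier current -/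

namespace KerrSchild.Background

/-- **`|(J^X)^μ| ≤ 6 (1 + Φ) Ξ ∑_κ (∂_κ w)²`** on a background, for a multiplier with `|X^α(x)| ≤ Ξ`:
`(J^X)^μ = A^μ X(w) − ½ X^μ Q` with `|A^μ| ≤ (1 + Φ)∑|p|`, `|X(w)| ≤ Ξ ∑|p|`, `|Q| ≤ (1 + Φ)(∑|p|)²`,
`(∑|p|)² ≤ 4 ∑ p²`. [folklore] -/
theorem abs_multiplierCurrent_le (B : Background) {X : E4 → Fin 4 → ℝ} (w : E4 → ℝ) (x : E4)
    {Ξ : ℝ} (hΞ : ∀ α, |X x α| ≤ Ξ) (μ : Fin 4) :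
    |multiplierCurrent B.inverseMetric X w x μ| ≤
      6 * (1 + B.bound) * Ξ * ∑ κ, fderiv ℝ w x (E4.basisVector κ) ^ 2 := by
  set p : Fin 4 → ℝ := fun κ ↦ fderiv ℝ w x (E4.basisVector κ) with hp
  set S : ℝ := ∑ κ, p κ ^ 2 with hS
  set Tt : ℝ := ∑ κ, |p κ| with hT
  have hΞ0 : 0 ≤ Ξ := (abs_nonneg _).trans (hΞ 0)
  have hΦ0 : 0 ≤ B.bound := (B.φ_nonneg x).trans (B.φ_le x)
  have hA : ∀ α β, |B.inverseMetric x α β| ≤ 1 + B.bound := B.abs_inverseMetric_le x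
  have hT0 : 0 ≤ Tt := Finset.sum_nonneg fun _ _ ↦ abs_nonneg _
  have hsq : Tt ^ 2 ≤ 4 * S := Kerr.sq_sum_abs_le_four_mul p
  have h1 : ∀ α, |∑ ν, B.inverseMetric x α ν * p ν| ≤ (1 + B.bound) * Tt := by
    intro α
    calc _ ≤ ∑ ν, |B.inverseMetric x α ν * p ν| := Finset.abs_sum_le_sum_abs _ _
      _ ≤ ∑ ν, (1 + B.bound) * |p ν| := Finset.sum_le_sum fun ν _ ↦ by
          rw [abs_mul]; exact mul_le_mul_of_nonneg_right (hA α ν) (abs_nonneg _)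
      _ = (1 + B.bound) * Tt := by rw [hT, Finset.mul_sum]
  have h2 : |∑ α, ∑ β, B.inverseMetric x α β * p α * p β| ≤ (1 + B.bound) * Tt * Tt :=
    Kerr.abs_sum_sum_mul_mul_le _ p p hA
  have h3 : |∑ α, X x α * p α| ≤ Ξ * Tt := by
    calc _ ≤ ∑ α, |X x α * p α| := Finset.abs_sum_le_sum_abs _ _
      _ ≤ ∑ α, Ξ * |p α| := Finset.sum_le_sum fun α _ ↦ by
          rw [abs_mul]; exact mul_le_mul_of_nonneg_right (hΞ α) (abs_nonneg _)
      _ = Ξ * Tt := by rw [hT, Finset.mul_sum]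
  have hJ : multiplierCurrent B.inverseMetric X w x μ =
      (∑ ν, B.inverseMetric x μ ν * p ν) * (∑ α, X x α * p α) -
        2⁻¹ * X x μ * ∑ α, ∑ β, B.inverseMetric x α β * p α * p β := by
    simp only [multiplierCurrent, hp]
  rw [hJ]
  calc |(∑ ν, B.inverseMetric x μ ν * p ν) * (∑ α, X x α * p α) -
        2⁻¹ * X x μ * ∑ α, ∑ β, B.inverseMetric x α β * p α * p β|
      ≤ |(∑ ν, B.inverseMetric x μ ν * p ν) * (∑ α, X x α * p α)| +
          |2⁻¹ * X x μ * ∑ α, ∑ β, B.inverseMetric x α β * p α * p β| := abs_sub _ _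
    _ ≤ (1 + B.bound) * Tt * (Ξ * Tt) + 2⁻¹ * Ξ * ((1 + B.bound) * Tt * Tt) := by
        refine add_le_add ?_ ?_
        · rw [abs_mul]
          exact mul_le_mul (h1 μ) h3 (abs_nonneg _) (by positivity)
        · rw [abs_mul, abs_mul, abs_of_pos (by norm_num : (0 : ℝ) < 2⁻¹)]
          exact mul_le_mul (mul_le_mul_of_nonneg_left (hΞ μ) (by norm_num)) h2 (abs_nonneg _)
            (by positivity)
    _ = 3 / 2 * (1 + B.bound) * Ξ * Tt ^ 2 := by ring
    _ ≤ 3 / 2 * (1 + B.bound) * Ξ * (4 * S) := by gcongr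
    _ = 6 * (1 + B.bound) * Ξ * S := by ring

end KerrSchild.Background

namespace Kerr

variable {M a : ℝ} {x : E4}

/-! ## Part 1. Bounds on `t*`-invariant continuous functions on radial slabs -/

/-- **A `t*`-invariant function continuous on `{r > 0}` is bounded on `{r₀ ≤ r ≤ R}`** (`r₀ > 0`):
the slab `{x⁰ = 0, r₀ ≤ r ≤ R}` is compact (`Kerr.isCompact_timeZero_radius_slab`). [folklore] -/
theorem exists_forall_abs_le_of_continuousOn_slab (a : ℝ) {r₀ R : ℝ} (hr₀ : 0 < r₀) (f : E4 → ℝ)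
    (hcont : ContinuousOn f {x | 0 < radius a x})
    (hinv : ∀ (x : E4) (t : ℝ), f (x + t • E4.basisVector 0) = f x) :
    ∃ C : ℝ, ∀ x : E4, r₀ ≤ radius a x → radius a x ≤ R → |f x| ≤ C := by
  set K : Set E4 := {x | x 0 = 0 ∧ |radius a x - (r₀ + R) / 2| ≤ (R - r₀) / 2} with hK
  have hKc : IsCompact K := isCompact_timeZero_radius_slab a (by linarith)
  have hpos : ∀ x ∈ K, 0 < radius a x := fun x hx ↦ by
    have := (abs_le.mp hx.2).1
    linarith
  obtain ⟨C, hC⟩ := hKc.exists_bound_of_continuousOn (hcont.mono fun x hx ↦ hpos x hx)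
  refine ⟨C, fun x h1 h2 ↦ ?_⟩
  set x₀ : E4 := x + (-(x 0)) • E4.basisVector 0 with hx₀_def
  have hx₀0 : x₀ 0 = 0 := by simp [hx₀_def, E4.basisVector]
  have hx₀r : radius a x₀ = radius a x := radius_add_time_smul_basisVector a x _
  have hx₀K : x₀ ∈ K := ⟨hx₀0, by rw [hx₀r]; exact abs_le.mpr ⟨by linarith, by linarith⟩⟩
  have h := hC x₀ hx₀K
  rw [Real.norm_eq_abs, hinv] at h
  exact h

/-- **The components of `N` are bounded on `{r₀ ≤ r ≤ R}`** (`r₀ > 0`). [folklore] -/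
theorem exists_abs_redShiftVector_le (M a h₁ f₁ : ℝ) {r₀ R : ℝ} (hr₀ : 0 < r₀) :
    ∃ Ξ : ℝ, 0 ≤ Ξ ∧ ∀ x : E4, r₀ ≤ radius a x → radius a x ≤ R →
      ∀ μ, |redShiftVector M a h₁ f₁ x μ| ≤ Ξ := by
  have h : ∀ μ, ∃ C : ℝ, ∀ x : E4, r₀ ≤ radius a x → radius a x ≤ R →
      |redShiftVector M a h₁ f₁ x μ| ≤ C := fun μ ↦
    exists_forall_abs_le_of_continuousOn_slab a hr₀ (fun x ↦ redShiftVector M a h₁ f₁ x μ)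
      (fun x hx ↦ (contDiffAt_redShiftVector_apply M a h₁ f₁ hx μ (n := 1)).continuousAt
        |>.continuousWithinAt)
      (fun x t ↦ by rw [redShiftVector_add_smul_basisVector_zero])
  choose C hC using h
  refine ⟨max 0 (Finset.univ.sup' Finset.univ_nonempty C), le_max_left _ _, fun x h1 h2 μ ↦ ?_⟩
  exact (hC μ x h1 h2).trans ((Finset.le_sup' C (Finset.mem_univ μ)).trans (le_max_right _ _))

/-! ## Part 2. The lowered covector of `N` and the cone structure at exterior points -/

/-- **The lowered covector `ξ = g(N, ·)` of the red-shift multiplier**: `ξ_β = g(N, ∂_β)`, so that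
`N^α = ∑_β g^{αβ} ξ_β` (`redShiftVector_eq_sum_inverseMetric_mul_redShiftCovector`).
[cite: DafermosRodnianski2008, App. D] -/
def redShiftCovector (M a h₁ f₁ : ℝ) (x : E4) : Fin 4 → ℝ :=
  fun β ↦ bilin M a x (redShiftVec M a h₁ f₁ x) (E4.basisVector β)

/-- **`N = g⁻¹ ξ`**: `N^α = ∑_β g^{αβ} ξ_β` wherever `r > 0` (`g⁻¹ g = 1`,
`Kerr.sum_inverseMetric_mul_bilin`). [cite: DafermosRodnianski2008, App. D] -/
theorem redShiftVector_eq_sum_inverseMetric_mul_redShiftCovector (M a h₁ f₁ : ℝ)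
    (hx : 0 < radius a x) (α : Fin 4) :
    redShiftVector M a h₁ f₁ x α = ∑ β, inverseMetric M a x α β * redShiftCovector M a h₁ f₁ x β := by
  set N : E4 := redShiftVec M a h₁ f₁ x with hN
  have hξ : ∀ β, redShiftCovector M a h₁ f₁ x β =
      ∑ γ, N γ * bilin M a x (E4.basisVector γ) (E4.basisVector β) := fun β ↦
    bilin_eq_sum_apply M a x N (E4.basisVector β)
  simp only [hξ, Finset.mul_sum]
  rw [Finset.sum_comm]
  have h : ∀ γ, ∑ β, inverseMetric M a x α β * (N γ * bilin M a x (E4.basisVector γ) (E4.basisVector β))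
      = N γ * if α = γ then 1 else 0 := by
    intro γ
    rw [← sum_inverseMetric_mul_bilin M a hx α γ, Finset.mul_sum]
    exact Finset.sum_congr rfl fun β _ ↦ by rw [bilin_symm M a x (E4.basisVector γ)]; ring
  simp only [h, mul_ite, mul_one, mul_zero, Finset.sum_ite_eq, Finset.mem_univ, if_true]
  rw [← redShiftVec_apply]

/-- **`G(ξ, n) = n(N)`** for the lowered covector: `∑_{αβ} g^{αβ} ξ_α n_β = ∑_β N^β n_β`.
[cite: DafermosRodnianski2008, App. D] -/
theorem toBilin'_inverseMetric_redShiftCovector (M a h₁ f₁ : ℝ) (hx : 0 < radius a x)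
    (n : Fin 4 → ℝ) :
    Matrix.toBilin' (inverseMetric M a x) (redShiftCovector M a h₁ f₁ x) n =
      ∑ μ, n μ * redShiftVector M a h₁ f₁ x μ := by
  rw [Matrix.toBilin'_apply, Finset.sum_comm]
  refine Finset.sum_congr rfl fun μ _ ↦ ?_
  rw [redShiftVector_eq_sum_inverseMetric_mul_redShiftCovector M a h₁ f₁ hx μ, Finset.mul_sum]
  exact Finset.sum_congr rfl fun β _ ↦ by rw [inverseMetric_symm M a x μ β]; ring

/-- **`G(ξ, ξ) = g(N, N)`** for the lowered covector. [cite: DafermosRodnianski2008, App. D] -/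
theorem toBilin'_inverseMetric_redShiftCovector_self (M a h₁ f₁ : ℝ) (hx : 0 < radius a x) :
    Matrix.toBilin' (inverseMetric M a x) (redShiftCovector M a h₁ f₁ x)
        (redShiftCovector M a h₁ f₁ x) =
      bilin M a x (redShiftVec M a h₁ f₁ x) (redShiftVec M a h₁ f₁ x) := by
  rw [toBilin'_inverseMetric_redShiftCovector M a h₁ f₁ hx]
  set N : E4 := redShiftVec M a h₁ f₁ x with hN
  have h : bilin M a x N N = bilin M a x N (∑ μ, N μ • E4.basisVector μ) :=
    congrArg (bilin M a x N) (eq_sum_basisVector N)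
  rw [h, map_sum]
  refine Finset.sum_congr rfl fun μ _ ↦ ?_
  rw [map_smul, smul_eq_mul, redShiftCovector, ← redShiftVec_apply]
  ring

/-- **On `{r ≥ r₀}` the surgered background has the Kerr inverse metric** (pointwise).
[cite: KerrSchild1965, §2] -/
theorem surgeryBackground_inverseMetric_eq {M : ℝ} (hM : 0 ≤ M) (a : ℝ) {r₀ : ℝ} (hr₀ : 0 < r₀)
    (hx : r₀ ≤ radius a x) :
    (surgeryBackground M a r₀ hM hr₀).inverseMetric x = inverseMetric M a x := by
  funext μ ν
  simp only [KerrSchild.Background.inverseMetric, surgeryBackground_φ, surgeryBackground_l,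
    KerrSchild.inverseMetric, surgeryProfile_eq_of_le hr₀ hx, inverseMetric_eq_kerrSchild]

/-- **Admissible conormals are causal**: for `n = (1, −q)` with `|q| ≤ 1`,
`G(n, n) = −1 + |q|² − 2H (ℓ♯(n))² ≤ 0` (`M ≥ 0`). [cite: DafermosRodnianskiShlapentokhrothman2014, §3.3] -/
theorem toBilin'_inverseMetric_admissible_nonpos (hM : 0 ≤ M) (a : ℝ) (x : E4) {n : Fin 4 → ℝ}
    (hn : n ∈ admissibleConormals) : Matrix.toBilin' (inverseMetric M a x) n n ≤ 0 := by
  obtain ⟨h0, hs⟩ := hn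
  have hH := scalarH_nonneg hM a x
  rw [Matrix.toBilin'_apply]
  simp only [inverseMetric_apply, Fin.sum_univ_four, Fin.isValue, h0]
  simp only [show (1 : Fin 4) ≠ 0 from by decide, show (2 : Fin 4) ≠ 0 from by decide,
    show (3 : Fin 4) ≠ 0 from by decide, show (0 : Fin 4) ≠ 1 from by decide,
    show (0 : Fin 4) ≠ 2 from by decide, show (0 : Fin 4) ≠ 3 from by decide,
    show (1 : Fin 4) ≠ 2 from by decide, show (1 : Fin 4) ≠ 3 from by decide,
    show (2 : Fin 4) ≠ 1 from by decide, show (2 : Fin 4) ≠ 3 from by decide,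
    show (3 : Fin 4) ≠ 1 from by decide, show (3 : Fin 4) ≠ 2 from by decide, if_true, if_false]
  rw [Fin.sum_univ_three] at hs
  simp only [Fin.succ_zero_eq_one, Fin.succ_one_eq_two] at hs
  rw [show ((2 : Fin 3).succ : Fin 4) = 3 from rfl] at hs
  set l0 := nullVector a x 0
  set l1 := nullVector a x 1
  set l2 := nullVector a x 2
  set l3 := nullVector a x 3
  have hsq : 0 ≤ 2 * scalarH M a x * (l0 * 1 + l1 * n 1 + l2 * n 2 + l3 * n 3) ^ 2 := by positivity
  nlinarith [hsq]

/-! ## Part 3. The leaf term: `−∑ (J^N)^μ n_μ ≥ 0` -/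

/-- **The `N`-energy density through an admissible leaf is non-negative near the horizon**
(dominant energy condition; DRSR §2.3.2). Let `x` be an exterior point (`r > r₊`, `|a| < M`) at
which `N` is timelike, `g(N, N) < 0`, and let `n = (1, −q)`, `|q| ≤ 1`, be an admissible conormal
with `n(N) > 0` (both hold on the collar of `Kerr.exists_redShift_timelike_collar`). Then for the
surgered background `B = Kerr.surgeryBackground M a r₊` (`= g_{M,a}⁻¹` at `x`) and every `w`,
`0 ≤ −∑_μ (J^N)^μ[w](x) n_μ`. [cite: DafermosRodnianskiShlapentokhrothman2014, §2.3.2] -/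
theorem neg_sum_redShiftCurrent_mul_nonneg (hMa : IsSubextremal M a) {h₁ f₁ : ℝ}
    (hx : rPlus M a < radius a x)
    (hNN : bilin M a x (redShiftVec M a h₁ f₁ x) (redShiftVec M a h₁ f₁ x) < 0)
    {n : Fin 4 → ℝ} (hn : n ∈ admissibleConormals)
    (hco : 0 < ∑ μ, n μ * redShiftVector M a h₁ f₁ x μ) (w : E4 → ℝ) :
    0 ≤ -∑ μ, KerrSchild.multiplierCurrent
      (surgeryBackground M a (rPlus M a) hMa.pos.le hMa.rPlus_pos).inverseMetric
      (redShiftVector M a h₁ f₁) w x μ * n μ := by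
  set B := surgeryBackground M a (rPlus M a) hMa.pos.le hMa.rPlus_pos with hB
  have hxpos : 0 < radius a x := hMa.rPlus_pos.trans hx
  have hG : B.inverseMetric x = inverseMetric M a x :=
    surgeryBackground_inverseMetric_eq hMa.pos.le a hMa.rPlus_pos hx.le
  have hX : ∀ α, redShiftVector M a h₁ f₁ x α =
      ∑ β, B.inverseMetric x α β * redShiftCovector M a h₁ f₁ x β := fun α ↦ by
    rw [hG]; exact redShiftVector_eq_sum_inverseMetric_mul_redShiftCovector M a h₁ f₁ hxpos α
  have hξ : Matrix.toBilin' (B.inverseMetric x) (redShiftCovector M a h₁ f₁ x)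
      (redShiftCovector M a h₁ f₁ x) < 0 := by
    rw [hG, toBilin'_inverseMetric_redShiftCovector_self M a h₁ f₁ hxpos]; exact hNN
  have hν : Matrix.toBilin' (B.inverseMetric x) (-n) (-n) ≤ 0 := by
    simp only [map_neg, LinearMap.neg_apply, neg_neg]
    rw [hG]
    exact toBilin'_inverseMetric_admissible_nonpos hMa.pos.le a x hn
  have hco' : Matrix.toBilin' (B.inverseMetric x) (redShiftCovector M a h₁ f₁ x) (-n) < 0 := by
    simp only [map_neg, neg_lt_zero]
    rw [hG, toBilin'_inverseMetric_redShiftCovector M a h₁ f₁ hxpos]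
    exact hco
  have h := B.sum_multiplierCurrent_mul_nonneg w hX hξ hν hco'
  simpa [Finset.sum_neg_distrib] using h

/-! ## Part 4. The receding inner boundary term: `∑ ∂_μ[χ(u₂/ε − 1)] (J^N)^μ ≥ 0` -/

/-- `dr(v) = ∑ᵢ (∇r)ᵢ vᵢ` (local copy of `Kerr.radiusGrad_apply_sum` of `KerrLeafCoercivity.lean`,
not imported here). [folklore] -/
private theorem radiusGrad_apply_sum' (a : ℝ) (y v : E3) :
    radiusGrad a y v = ∑ i : Fin 3, radiusGradVec a y i * v i := by
  rw [radiusGrad_apply]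
  simp only [EuclideanSpace.inner_eq_star_dotProduct, star_trivial, dotProduct]
  exact Finset.sum_congr rfl fun i _ ↦ mul_comm _ _

/-- `χ' ≥ 0` (`χ = Real.smoothTransition` is monotone; local copy). [folklore] -/
private theorem deriv_smoothTransition_nonneg' (s : ℝ) : 0 ≤ deriv Real.smoothTransition s :=
  Real.smoothTransition.monotone.deriv_nonneg

/-- `χ` is differentiable with derivative `χ'` (local copy). [folklore] -/
private theorem hasDerivAt_smoothTransition' (s : ℝ) :
    HasDerivAt Real.smoothTransition (deriv Real.smoothTransition s) s :=
  ((Real.smoothTransition.contDiffAt (n := 1)).differentiableAt (by simp)).hasDerivAt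

/-- **`N(r) = −(1 + f₁(r − r₊))`**: `dr(N) = (1 + h₁s) K(r) − (1 + f₁s) ℓ♯(r)` with `K(r) = 0`
(`Kerr.sum_hawkingVector_mul_dRadius`) and `ℓ♯(r) = 1` (`Kerr.sum_nullVector_mul_dRadius`).
[folklore] -/
theorem fderiv_radius_redShiftVec (M a h₁ f₁ : ℝ) (hx : 0 < radius a x) :
    fderiv ℝ (radius a) x (redShiftVec M a h₁ f₁ x) = -(1 + f₁ * (radius a x - rPlus M a)) := by
  rw [← sum_mul_fderiv_basisVector]
  have hK := sum_hawkingVector_mul_dRadius M a hx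
  have hℓ := sum_nullVector_mul_dRadius hx
  simp only [dRadius_apply] at hK hℓ
  simp only [redShiftVec_apply, redShiftVector, add_mul, Finset.sum_add_distrib, mul_assoc,
    ← Finset.mul_sum, hK, hℓ]
  ring

/-- **Flux of `J^N` through the receding inner boundary has the good sign.** At an exterior point
`x` (`r > r₊`, `|a| < M`) where `N` is timelike (`g(N, N) < 0`), `N⁰ ≥ 0` and
`1 + f₁(r − r₊) > 0`, for `B = Kerr.surgeryBackground M a r₊`, every `w` and every `ε > 0`:
`0 ≤ ∑_μ ∂_μ[χ(u₂/ε − 1)](x) (J^N)^μ[w](x)` (`u₂ = Kerr.horizonFn`, `χ = Real.smoothTransition`).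
Indeed `d[χ(u₂/ε − 1)] = −k ν` with `k ≥ 0` and `ν = ṡ dt* − dr`, `ṡ = (r − r₊)/(2M)`, a past causal
covector co-oriented with `dt*` (`Kerr.horizonCovector_causal`, as in `Kerr.horizonFactor_flux`),
and `ν(N) = ṡ N⁰ + (1 + f₁(r − r₊)) > 0` (`fderiv_radius_redShiftVec`), so `−ν` is future causal with
`(−ν)(N) < 0` and `∑ (J^N)^μ ν_μ ≤ 0` by the dominant energy condition
(`KerrSchild.Background.sum_multiplierCurrent_mul_nonneg`). This is the statement "the horizon
flux `∫_{𝓗⁺} J^N_μ n^μ` is non-negative" of DRSR §2.3.2 for the smeared horizon.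
[cite: DafermosRodnianskiShlapentokhrothman2014, §2.3.2] -/
theorem redShift_horizonFactor_flux (hMa : IsSubextremal M a) {h₁ f₁ : ℝ} (w : E4 → ℝ) {ε : ℝ}
    (hε : 0 < ε) (hx : rPlus M a < radius a x)
    (hNN : bilin M a x (redShiftVec M a h₁ f₁ x) (redShiftVec M a h₁ f₁ x) < 0)
    (hN0 : 0 ≤ redShiftVec M a h₁ f₁ x 0) (hβ : 0 < 1 + f₁ * (radius a x - rPlus M a)) :
    0 ≤ ∑ μ, fderiv ℝ (fun y ↦ Real.smoothTransition (horizonFn M a y / ε - 1)) x (E4.basisVector μ) *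
      KerrSchild.multiplierCurrent
        (surgeryBackground M a (rPlus M a) hMa.pos.le hMa.rPlus_pos).inverseMetric
        (redShiftVector M a h₁ f₁) w x μ := by
  set B := surgeryBackground M a (rPlus M a) hMa.pos.le hMa.rPlus_pos with hB
  have hM : 0 < M := hMa.pos
  have hrp : 0 < rPlus M a := hMa.rPlus_pos
  have hxpos : 0 < radius a x := hrp.trans hx
  have hG : B.inverseMetric x = inverseMetric M a x :=
    surgeryBackground_inverseMetric_eq hMa.pos.le a hMa.rPlus_pos hx.le
  -- the conormal `ν = ṡ dt* − dr`
  set s : ℝ := (2 * M)⁻¹ * (radius a x - rPlus M a) with hs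
  have hs0 : 0 ≤ s := mul_nonneg (by positivity) (by linarith)
  have hΔ : radius a x ^ 2 - 2 * M * radius a x + a ^ 2 ≤ 4 * M * radius a x * s := by
    have h1 := delta_le_mul_sub_rPlus hMa hx
    have h2 : 4 * M * radius a x * s = 2 * (radius a x * (radius a x - rPlus M a)) := by
      rw [hs]; field_simp; ring
    rw [h2]
    nlinarith [mul_nonneg hxpos.le (sub_nonneg.mpr hx.le)]
  set ν : Fin 4 → ℝ := ![s, -radiusGradVec a (E4.spatial x) 0, -radiusGradVec a (E4.spatial x) 1,
    -radiusGradVec a (E4.spatial x) 2] with hν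
  have hφ : surgeryProfile M a (rPlus M a) x = 2 * scalarH M a x := surgeryProfile_eq_of_le hrp hx.le
  obtain ⟨hcausal, -⟩ := horizonCovector_causal hM.le hxpos hφ hs0 hΔ ν rfl rfl rfl rfl
  -- `ν(N) = s N⁰ + (1 + f₁(r − r₊)) > 0`
  have hdr : ∑ i : Fin 3, radiusGradVec a (E4.spatial x) i * redShiftVec M a h₁ f₁ x i.succ =
      -(1 + f₁ * (radius a x - rPlus M a)) := by
    rw [← fderiv_radius_redShiftVec M a h₁ f₁ hxpos, (hasFDerivAt_radius hxpos).fderiv,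
      ContinuousLinearMap.comp_apply, radiusGrad_apply_sum']
    rfl
  have hνN : ∑ μ, ν μ * redShiftVector M a h₁ f₁ x μ =
      s * redShiftVector M a h₁ f₁ x 0 + (1 + f₁ * (radius a x - rPlus M a)) := by
    rw [Fin.sum_univ_three] at hdr
    simp only [Fin.succ_zero_eq_one, Fin.succ_one_eq_two, Fin.isValue, redShiftVec_apply] at hdr
    rw [show ((2 : Fin 3).succ : Fin 4) = 3 from rfl] at hdr
    have hν0 : ν 0 = s := rfl
    have hν1 : ν 1 = -radiusGradVec a (E4.spatial x) 0 := rfl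
    have hν2 : ν 2 = -radiusGradVec a (E4.spatial x) 1 := rfl
    have hν3 : ν 3 = -radiusGradVec a (E4.spatial x) 2 := rfl
    rw [Fin.sum_univ_four, hν0, hν1, hν2, hν3]
    linarith
  have hνN_pos : 0 < ∑ μ, ν μ * redShiftVector M a h₁ f₁ x μ := by
    rw [hνN]
    rw [redShiftVec_apply] at hN0
    have := mul_nonneg hs0 hN0
    linarith
  -- the dominant energy condition with the future causal covector `−ν`
  have hX : ∀ α, redShiftVector M a h₁ f₁ x α =
      ∑ β, B.inverseMetric x α β * redShiftCovector M a h₁ f₁ x β := fun α ↦ by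
    rw [hG]; exact redShiftVector_eq_sum_inverseMetric_mul_redShiftCovector M a h₁ f₁ hxpos α
  have hξ : Matrix.toBilin' (B.inverseMetric x) (redShiftCovector M a h₁ f₁ x)
      (redShiftCovector M a h₁ f₁ x) < 0 := by
    rw [hG, toBilin'_inverseMetric_redShiftCovector_self M a h₁ f₁ hxpos]; exact hNN
  have hcausal' : Matrix.toBilin' (B.inverseMetric x) (-ν) (-ν) ≤ 0 := by
    simp only [map_neg, LinearMap.neg_apply, neg_neg]
    rw [Matrix.toBilin'_apply]
    have : ∑ i, ∑ j, ν i * B.inverseMetric x i j * ν j =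
        ∑ μ, ∑ κ, KerrSchild.inverseMetric (surgeryProfile M a (rPlus M a)) (nullVector a) x μ κ *
          ν μ * ν κ := by
      refine Finset.sum_congr rfl fun i _ ↦ Finset.sum_congr rfl fun j _ ↦ ?_
      rw [hB]
      simp only [KerrSchild.Background.inverseMetric, surgeryBackground_φ, surgeryBackground_l]
      ring
    rw [this]
    exact hcausal
  have hco : Matrix.toBilin' (B.inverseMetric x) (redShiftCovector M a h₁ f₁ x) (-ν) < 0 := by
    simp only [map_neg, neg_lt_zero]
    rw [hG, toBilin'_inverseMetric_redShiftCovector M a h₁ f₁ hxpos]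
    exact hνN_pos
  have hdec := B.sum_multiplierCurrent_mul_nonneg w hX hξ hcausal' hco
  -- `∑ (J^N)·ν ≤ 0`
  have hJν : ∑ μ, KerrSchild.multiplierCurrent B.inverseMetric (redShiftVector M a h₁ f₁) w x μ *
      ν μ ≤ 0 := by
    have : ∑ μ, KerrSchild.multiplierCurrent B.inverseMetric (redShiftVector M a h₁ f₁) w x μ *
        (-ν) μ = -∑ μ, KerrSchild.multiplierCurrent B.inverseMetric (redShiftVector M a h₁ f₁) w x μ *
          ν μ := by
      simp [Finset.sum_neg_distrib]
    rw [this] at hdec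
    linarith
  -- the derivative of the factor is `−k ν`, `k ≥ 0` (as in `Kerr.horizonFactor_flux`)
  have hdiff : HasFDerivAt (horizonFn M a) (fderiv ℝ (horizonFn M a) x) x :=
    ((contDiffAt_horizonFn M hxpos (n := 1)).differentiableAt (by simp)).hasFDerivAt
  have haff : HasDerivAt (fun u : ℝ ↦ u / ε - 1) (1 / ε) (horizonFn M a x) :=
    ((hasDerivAt_id _).div_const ε).sub_const 1
  have hd : HasFDerivAt (fun y ↦ Real.smoothTransition (horizonFn M a y / ε - 1))
      ((deriv Real.smoothTransition (horizonFn M a x / ε - 1) * (1 / ε)) •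
        fderiv ℝ (horizonFn M a) x) x :=
    ((hasDerivAt_smoothTransition' _).comp _ haff).comp_hasFDerivAt x hdiff
  set k : ℝ := deriv Real.smoothTransition (horizonFn M a x / ε - 1) * (1 / ε) *
    Real.exp (-((2 * M)⁻¹ * x 0)) with hk
  have hk0 : 0 ≤ k :=
    mul_nonneg (mul_nonneg (deriv_smoothTransition_nonneg' _) (by positivity)) (Real.exp_pos _).le
  have e0 : fderiv ℝ (fun y ↦ Real.smoothTransition (horizonFn M a y / ε - 1)) x
      (E4.basisVector 0) = -(k * ν 0) := by
    rw [hd.fderiv, FunLike.coe_smul, Pi.smul_apply, smul_eq_mul,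
      fderiv_horizonFn_basisVector_zero hxpos, show ν 0 = s from rfl, hk, hs]
    ring
  have es : ∀ i : Fin 3, fderiv ℝ (fun y ↦ Real.smoothTransition (horizonFn M a y / ε - 1)) x
      (E4.basisVector i.succ) = -(k * -radiusGradVec a (E4.spatial x) i) := by
    intro i
    rw [hd.fderiv, FunLike.coe_smul, Pi.smul_apply, smul_eq_mul,
      fderiv_horizonFn_basisVector_succ hxpos, hk]
    ring
  have e1 : fderiv ℝ (fun y ↦ Real.smoothTransition (horizonFn M a y / ε - 1)) x
      (E4.basisVector 1) = -(k * ν 1) := es 0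
  have e2 : fderiv ℝ (fun y ↦ Real.smoothTransition (horizonFn M a y / ε - 1)) x
      (E4.basisVector 2) = -(k * ν 2) := es 1
  have e3 : fderiv ℝ (fun y ↦ Real.smoothTransition (horizonFn M a y / ε - 1)) x
      (E4.basisVector 3) = -(k * ν 3) := es 2
  rw [Fin.sum_univ_four] at hJν ⊢
  rw [e0, e1, e2, e3]
  have hk' := mul_nonpos_iff.mpr (Or.inl ⟨hk0, hJν⟩)
  nlinarith [hk']

end Kerr

end Literature.Geometry.Lorentzian
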